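import Summits.Ventures.LatticeQCDFlow.Scaling.BooleanStarOneCopyDrift

/-!
HONEST FRAMING: exact (Metropolis-corrected) sampling algorithms for lattice gauge theory; figures
of merit are autocorrelation/cost numbers at stated couplings and volumes; no continuum-physics
claim.

# BooleanStarSmallPoolLaw — THE ONE-DIMENSIONAL ROUTE WITH THE TWO SIMPLEST POTENTIALS: `φ ≡ 0` GIVES THE DEFECT-COUNT RATE `c(p·h + rr·t)/(h+2t)²`
# FOR EVERY LAW, AND `φ = B` GIVES THE CONJECTURED ORDER `K/(μ_0(b)·min{t,h})` WHENEVER THE EQUILIBRIUM POOL OF DISLIKED COLD LEVELS IS SMALL,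
# `μ_1(b̄)·K ≤ μ_1(b)/2` — NO OTHER HYPOTHESIS (lean-2 GEN-33, ours)

Venture-side (OURS).  Cell `lqcd-flow` (pub-lqcd), unit `pub-lqcd-lean-2-g33`, 2026-08-29.  Chapter T, file 0, on top of `BooleanStarOneCopyDrift` (S9).
S9 reduced OPEN-MATH item 1 (ii) for the homogeneous Boolean star (persistent hub, `K` idle cold levels, uniform entry list, exact hot redraws; all `K`) to a drift
inequality for a function `φ` of ONE copy's cold `b̄`-count `B ∈ {0,…,K}` (down-probability `μ_0(b)π_b(B)`, up-probability `μ_0(b̄)π_b̄(B)` per redraw cycle;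
`c = t/K`, `h = (1−t)w_0`, `Δ(B) = h + cB + c·rr(K−B+1)`, `π_b(B) = cB/Δ(B)`, `π_b̄(B) = c·rr(K−B)/Δ(B+1)`).  This file records the two simplest instances, which
between them already cover everything except the macroscopic-pool corner, and which the unconditional law of this chapter (T4) uses as two of its three legs:

* **`oneCopyDrift_zero`** — `φ ≡ 0`: the inequality is `ρ(B₂ − B₁) ≤` coupling bracket, and the bracket is `≥ c(B₂−B₁)[μ_0(b)(h + rr·t) + μ_0(b̄)rr(h+t)]/(h+2t)²
  = c(B₂−B₁)(p·h + rr·t)/(h+2t)²` by the closed forms of the `π`-differences; so **`ρ₀ = c(p·h + rr·t)/(h+2t)²`** (`p = μ_0(b) + μ_0(b̄)rr`) passes for EVERY law —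
  the rate of S8's `boolStar_mixingTime_le_allK` (there `(3/4)ρ₀`, through the three-state determinant) recovered in one line of the 1-D language.
* **`oneCopyDrift_smallPool`** — `φ(x) = max{x,0}`: if the equilibrium pool is small, **`μ_0(b̄)·rr·K ≤ μ_0(b)/2`** (⟺ `μ_1(b̄)K ≤ μ_1(b)/2`: at most half a disliked cold
  level at equilibrium), then every up-step is at most half a down-step from `B ≥ 1` (`μ_0(b̄)π_b̄(B) ≤ μ_0(b̄)rrK·c/Δ(B) ≤ μ_0(b)cB/(2Δ(B))`), so
  `μ_0(b)π_b(B₂) − μ_0(b̄)π_b̄(B₂) ≥ μ_0(b)cB₂/(2(h+2t)) = ρB₂` with **`ρ = μ_0(b)c/(2(h+2t))`** — S10's clean-cold law WITHOUT its hypothesis `rr(K+1) ≤ 1/4` and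
  with `1/8` relaxed to `1/2`, constant `11/32` improved to `1/2`.
* **`boolStar_mixingTime_le_zeroPotential`**, **`boolStar_mixingTime_le_smallPool`** — the corresponding cold-start laws for the homogeneous Boolean star,
  `t_mix(ε) ≤ ⌈(4/(hρ))·log((eK+1)/ε)⌉₊` resp. `⌈(4/(hρ))·log((3eK+1)/ε)⌉₊`, via `boolStar_mixingTime_le_of_oneCopyDrift`.

What remains for item 1 (ii) on the homogeneous Boolean star after this file: the macroscopic-pool corner `μ_0(b̄)rrK ≥ μ_0(b)/2` with `rr ≤ μ_0(b)` (for
`rr ≥ μ_0(b)` the rate `ρ₀` is already of the conjectured order `p·c/(h+2t)` since then `p ≤ 2rr`) — files T1–T3 of this chapter.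
NOT CLAIMED: that corner; anything measured; optimal constants.  Literature grade (cell rule): OWN, elementary; nothing cited as a fact; no new bib keys.
-/

noncomputable section

namespace Summit.Ventures.LatticeQCDFlow.Scaling

/-! ## §1 The two one-dimensional drift inequalities -/

/-- **THE DRIFT INEQUALITY FOR `φ ≡ 0`, EVERY LAW.**  With `h > 0`, `0 < c ≤ t` (`t = cK`), `0 ≤ rr ≤ 1`, `μ_0(b), μ_0(b̄) ≥ 0`, for all naturals `B₁ < B₂ ≤ K` the
coupling bracket alone pays: `ρ₀(B₂ − B₁) ≤ μ_0(b)[π_b(B₂) − π_b(B₁)] + μ_0(b̄)[π_b̄(B₁) − π_b̄(B₂)]` with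
**`ρ₀ = c·(μ_0(b)(h + rr·t) + μ_0(b̄)·rr·(h + t))/(h+2t)²`** (`= c(p·h + rr·t)/(h+2t)²` when `μ_0(b) + μ_0(b̄) = 1`), because
`π_b(B₂) − π_b(B₁) = c(B₂−B₁)(h + c·rr(K+1))/(Δ(B₁)Δ(B₂))`, `π_b̄(B₁) − π_b̄(B₂) = c·rr(B₂−B₁)(h + c(K+1))/(Δ(B₁+1)Δ(B₂+1))` and every `Δ ≤ h + 2t`. [ours] -/
theorem oneCopyDrift_zero {h c t rr K μb μb' ρ : ℝ} {πb πb' φ : ℝ → ℝ} (hh : 0 < h) (hc : 0 < c) (hct : c ≤ t) (htK : t = c * K)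
    (hrr0 : 0 ≤ rr) (hrr1 : rr ≤ 1) (hμb : 0 ≤ μb) (hμb' : 0 ≤ μb')
    (hπb : ∀ B, πb B = c * B / (h + c * B + c * rr * (K - B + 1)))
    (hπb' : ∀ B, πb' B = c * (K - B) * rr / (h + c * (K - B) * rr + c * (B + 1)))
    (hφ : ∀ x, φ x = 0) (hρ : ρ = c * (μb * (h + rr * t) + μb' * rr * (h + t)) / (h + 2 * t) ^ 2)
    (B₁ B₂ : ℕ) (h12 : B₁ + 1 ≤ B₂) (h2K : (B₂ : ℝ) ≤ K) :
    ρ * ((B₂ : ℝ) - B₁ + φ B₁ + φ B₂) ≤ μb * (πb B₂ - πb B₁) + μb' * (πb' B₁ - πb' B₂)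
        + (μb * πb B₁ * (φ B₁ - φ (B₁ - 1)) - μb' * πb' B₁ * (φ (B₁ + 1) - φ B₁))
        + (μb * πb B₂ * (φ B₂ - φ (B₂ - 1)) - μb' * πb' B₂ * (φ (B₂ + 1) - φ B₂)) := by
  have hB1 : (B₁ : ℝ) + 1 ≤ B₂ := by exact_mod_cast h12
  have hB10 : (0 : ℝ) ≤ B₁ := Nat.cast_nonneg _
  have ht0 : 0 < t := lt_of_lt_of_le hc hct
  have hS : 0 < h + 2 * t := by linarith
  simp only [hφ, add_zero, mul_zero, sub_self]
  -- denominators, all in `(0, h + 2t]`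
  have dB : ∀ B : ℝ, 0 ≤ B → B ≤ K → 0 < h + c * B + c * rr * (K - B + 1) ∧ h + c * B + c * rr * (K - B + 1) ≤ h + 2 * t := fun B hB0 hBK => by
    have h1 : 0 ≤ c * rr * (K - B + 1) := mul_nonneg (mul_nonneg hc.le hrr0) (by linarith)
    have h2 : 0 ≤ c * B := by positivity
    have h3 : c * rr * (K - B + 1) ≤ c * 1 * (K - B + 1) :=
      mul_le_mul_of_nonneg_right (mul_le_mul_of_nonneg_left hrr1 hc.le) (by linarith)
    refine ⟨by linarith, ?_⟩
    have h4 : c * K = t := htK.symm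
    linarith
  have dB' : ∀ B : ℝ, 0 ≤ B → B ≤ K → 0 < h + c * (K - B) * rr + c * (B + 1) ∧ h + c * (K - B) * rr + c * (B + 1) ≤ h + 2 * t := fun B hB0 hBK => by
    have h1 : 0 ≤ c * (K - B) * rr := mul_nonneg (mul_nonneg hc.le (by linarith)) hrr0
    have h2 : 0 ≤ c * (B + 1) := by positivity
    have h3 : c * (K - B) * rr ≤ c * (K - B) * 1 := mul_le_mul_of_nonneg_left hrr1 (mul_nonneg hc.le (by linarith))
    refine ⟨by linarith, ?_⟩
    have h4 : c * K = t := htK.symm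
    linarith
  obtain ⟨d1, d1le⟩ := dB B₁ hB10 (by linarith)
  obtain ⟨d2, d2le⟩ := dB B₂ (by linarith) h2K
  obtain ⟨e1, e1le⟩ := dB' B₁ hB10 (by linarith)
  obtain ⟨e2, e2le⟩ := dB' B₂ (by linarith) h2K
  -- the two closed-form differences
  have s1 : πb B₂ - πb B₁ = c * ((B₂ : ℝ) - B₁) * (h + c * rr * (K + 1))
      / ((h + c * B₁ + c * rr * (K - B₁ + 1)) * (h + c * B₂ + c * rr * (K - B₂ + 1))) := by
    rw [hπb, hπb, div_sub_div _ _ d2.ne' d1.ne']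
    congr 1 <;> ring
  have s2 : πb' B₁ - πb' B₂ = c * rr * ((B₂ : ℝ) - B₁) * (h + c * (K + 1))
      / ((h + c * (K - B₁) * rr + c * (B₁ + 1)) * (h + c * (K - B₂) * rr + c * (B₂ + 1))) := by
    rw [hπb', hπb', div_sub_div _ _ e1.ne' e2.ne']
    congr 1; ring
  -- lower bounds with the common denominator `(h + 2t)²`
  have hK1 : 0 ≤ (K : ℝ) + 1 := by linarith
  have n1 : 0 ≤ c * ((B₂ : ℝ) - B₁) * (h + rr * t) := mul_nonneg (mul_nonneg hc.le (by linarith)) (by positivity)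
  have n2 : 0 ≤ c * rr * ((B₂ : ℝ) - B₁) * (h + t) := mul_nonneg (mul_nonneg (mul_nonneg hc.le hrr0) (by linarith)) (by linarith)
  have l1 : c * ((B₂ : ℝ) - B₁) * (h + rr * t) / (h + 2 * t) ^ 2 ≤ πb B₂ - πb B₁ := by
    rw [s1]
    have num : c * ((B₂ : ℝ) - B₁) * (h + rr * t) ≤ c * ((B₂ : ℝ) - B₁) * (h + c * rr * (K + 1)) := by
      apply mul_le_mul_of_nonneg_left _ (mul_nonneg hc.le (by linarith))
      rw [htK]; nlinarith [mul_nonneg hc.le hrr0]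
    calc c * ((B₂ : ℝ) - B₁) * (h + rr * t) / (h + 2 * t) ^ 2
        ≤ c * ((B₂ : ℝ) - B₁) * (h + rr * t) / ((h + c * B₁ + c * rr * (K - B₁ + 1)) * (h + c * B₂ + c * rr * (K - B₂ + 1))) := by
          apply div_le_div_of_nonneg_left n1 (mul_pos d1 d2)
          rw [sq]; exact mul_le_mul d1le d2le d2.le hS.le
      _ ≤ _ := div_le_div_of_nonneg_right num (mul_pos d1 d2).le
  have l2 : c * rr * ((B₂ : ℝ) - B₁) * (h + t) / (h + 2 * t) ^ 2 ≤ πb' B₁ - πb' B₂ := by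
    rw [s2]
    have num : c * rr * ((B₂ : ℝ) - B₁) * (h + t) ≤ c * rr * ((B₂ : ℝ) - B₁) * (h + c * (K + 1)) := by
      apply mul_le_mul_of_nonneg_left _ (mul_nonneg (mul_nonneg hc.le hrr0) (by linarith))
      rw [htK]; nlinarith
    calc c * rr * ((B₂ : ℝ) - B₁) * (h + t) / (h + 2 * t) ^ 2
        ≤ c * rr * ((B₂ : ℝ) - B₁) * (h + t) / ((h + c * (K - B₁) * rr + c * (B₁ + 1)) * (h + c * (K - B₂) * rr + c * (B₂ + 1))) := by
          apply div_le_div_of_nonneg_left n2 (mul_pos e1 e2)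
          rw [sq]; exact mul_le_mul e1le e2le e2.le hS.le
      _ ≤ _ := div_le_div_of_nonneg_right num (mul_pos e1 e2).le
  have m1 := mul_le_mul_of_nonneg_left l1 hμb
  have m2 := mul_le_mul_of_nonneg_left l2 hμb'
  have e : ρ * ((B₂ : ℝ) - B₁) = μb * (c * ((B₂ : ℝ) - B₁) * (h + rr * t) / (h + 2 * t) ^ 2)
      + μb' * (c * rr * ((B₂ : ℝ) - B₁) * (h + t) / (h + 2 * t) ^ 2) := by
    rw [hρ]; ring
  rw [e]; linarith

/-- **THE DRIFT INEQUALITY WHEN THE EQUILIBRIUM POOL IS SMALL.**  With `φ(x) = max{x, 0}` (the cold `b̄`-count itself), `h > 0`, `0 < c ≤ t` (`t = cK`),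
`0 ≤ rr ≤ 1`, `μ_0(b), μ_0(b̄) ≥ 0` and **`μ_0(b̄)·rr·K ≤ μ_0(b)/2`** (at most half a disliked cold level at equilibrium — the only hypothesis), for all naturals
`B₁ < B₂ ≤ K`: `ρ(B₂ − B₁ + φ(B₁) + φ(B₂)) ≤` bracket `+ d(B₁) + d(B₂)` with **`ρ = μ_0(b)·c/(2(h + 2t))`**: the whole right side is
`2[μ_0(b)π_b(B₂) − μ_0(b̄)π_b̄(B₂)]`, the up-step `μ_0(b̄)π_b̄(B₂) ≤ μ_0(b̄)·rr·K·c/Δ(B₂) ≤ μ_0(b)cB₂/(2Δ(B₂))` is at most half the down-step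
`μ_0(b)cB₂/Δ(B₂)`, and `Δ(B₂) ≤ h + 2t`. [ours] -/
theorem oneCopyDrift_smallPool {h c t rr K μb μb' ρ : ℝ} {πb πb' φ : ℝ → ℝ} (hh : 0 < h) (hc : 0 < c) (hct : c ≤ t) (htK : t = c * K)
    (hrr0 : 0 ≤ rr) (hrr1 : rr ≤ 1) (hμb : 0 ≤ μb) (hμb' : 0 ≤ μb') (hpool : μb' * rr * K ≤ μb / 2)
    (hπb : ∀ B, πb B = c * B / (h + c * B + c * rr * (K - B + 1)))
    (hπb' : ∀ B, πb' B = c * (K - B) * rr / (h + c * (K - B) * rr + c * (B + 1)))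
    (hφ : ∀ x, φ x = max x 0) (hρ : ρ = μb * c / (2 * (h + 2 * t)))
    (B₁ B₂ : ℕ) (h12 : B₁ + 1 ≤ B₂) (h2K : (B₂ : ℝ) ≤ K) :
    ρ * ((B₂ : ℝ) - B₁ + φ B₁ + φ B₂) ≤ μb * (πb B₂ - πb B₁) + μb' * (πb' B₁ - πb' B₂)
        + (μb * πb B₁ * (φ B₁ - φ (B₁ - 1)) - μb' * πb' B₁ * (φ (B₁ + 1) - φ B₁))
        + (μb * πb B₂ * (φ B₂ - φ (B₂ - 1)) - μb' * πb' B₂ * (φ (B₂ + 1) - φ B₂)) := by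
  have hB1 : (B₁ : ℝ) + 1 ≤ B₂ := by exact_mod_cast h12
  have hB10 : (0 : ℝ) ≤ B₁ := Nat.cast_nonneg _
  have hB21 : (1 : ℝ) ≤ B₂ := by linarith
  have ht0 : 0 < t := lt_of_lt_of_le hc hct
  have hS : 0 < h + 2 * t := by linarith
  -- values of `φ`
  have f2 : φ B₂ = B₂ := by rw [hφ]; exact max_eq_left (by linarith)
  have f2m : φ ((B₂ : ℝ) - 1) = B₂ - 1 := by rw [hφ]; exact max_eq_left (by linarith)
  have f2p : φ ((B₂ : ℝ) + 1) = B₂ + 1 := by rw [hφ]; exact max_eq_left (by linarith)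
  have f1 : φ B₁ = B₁ := by rw [hφ]; exact max_eq_left hB10
  have f1p : φ ((B₁ : ℝ) + 1) = B₁ + 1 := by rw [hφ]; exact max_eq_left (by linarith)
  -- `μ·π_b(B₁)·(φ(B₁) − φ(B₁−1)) = μ·π_b(B₁)`: either `B₁ ≥ 1` (unit step) or `B₁ = 0` (`π_b(0) = 0`)
  have f1m : μb * πb B₁ * (φ B₁ - φ ((B₁ : ℝ) - 1)) = μb * πb B₁ := by
    rcases Nat.eq_zero_or_pos B₁ with h0 | hpos
    · subst h0; rw [hπb]; simp
    · have : (1 : ℝ) ≤ B₁ := by exact_mod_cast hpos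
      rw [hφ, hφ, max_eq_left hB10, max_eq_left (by linarith)]; ring
  -- the denominator `Δ(B₂) ∈ (0, h + 2t]`, and `Δ(B₂) ≤ Δ(B₂+1)` (the denominator of `π_b̄(B₂)`, as `rr ≤ 1`)
  have d2 : 0 < h + c * B₂ + c * rr * (K - B₂ + 1) := by
    have h1 : 0 ≤ c * rr * (K - B₂ + 1) := mul_nonneg (mul_nonneg hc.le hrr0) (by linarith)
    have h2 : (0 : ℝ) ≤ c * B₂ := by positivity
    linarith
  have d2le : h + c * B₂ + c * rr * (K - B₂ + 1) ≤ h + 2 * t := by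
    have h3 : c * rr * (K - B₂ + 1) ≤ c * 1 * (K - B₂ + 1) :=
      mul_le_mul_of_nonneg_right (mul_le_mul_of_nonneg_left hrr1 hc.le) (by linarith)
    have h4 : c * K = t := htK.symm
    linarith
  have d2' : h + c * B₂ + c * rr * (K - B₂ + 1) ≤ h + c * (K - B₂) * rr + c * (B₂ + 1) := by
    have : 0 ≤ c * (1 - rr) := mul_nonneg hc.le (by linarith)
    nlinarith
  -- the down-step at `B₂` and the up-step at `B₂` (at most half the down-step)
  have down : μb * c * B₂ / (h + c * B₂ + c * rr * (K - B₂ + 1)) = μb * πb B₂ := by rw [hπb]; ring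
  have up : μb' * πb' B₂ ≤ μb * c * B₂ / (h + c * B₂ + c * rr * (K - B₂ + 1)) / 2 := by
    rw [hπb']
    have n0 : 0 ≤ c * ((K : ℝ) - B₂) * rr := mul_nonneg (mul_nonneg hc.le (by linarith)) hrr0
    have u1 : μb' * (c * (K - B₂) * rr / (h + c * (K - B₂) * rr + c * (B₂ + 1))) ≤ μb' * (c * (K - B₂) * rr / (h + c * B₂ + c * rr * (K - B₂ + 1))) :=
      mul_le_mul_of_nonneg_left (div_le_div_of_nonneg_left n0 d2 d2') hμb'
    have u2 : μb' * (c * (K - B₂) * rr) ≤ μb * c * B₂ / 2 := by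
      have a0 : 0 ≤ c * μb' * rr * B₂ := by positivity
      have a1 : μb' * (c * (K - B₂) * rr) = c * (μb' * rr * K) - c * μb' * rr * B₂ := by ring
      have a2 : c * (μb' * rr * K) ≤ c * (μb / 2) := mul_le_mul_of_nonneg_left hpool hc.le
      have a3 : μb * c * 1 ≤ μb * c * B₂ := mul_le_mul_of_nonneg_left hB21 (mul_nonneg hμb hc.le)
      linarith
    calc μb' * (c * (↑K - ↑B₂) * rr / (h + c * (↑K - ↑B₂) * rr + c * (↑B₂ + 1)))
        ≤ μb' * (c * (K - B₂) * rr / (h + c * B₂ + c * rr * (K - B₂ + 1))) := u1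
      _ = μb' * (c * (K - B₂) * rr) / (h + c * B₂ + c * rr * (K - B₂ + 1)) := by ring
      _ ≤ (μb * c * B₂ / 2) / (h + c * B₂ + c * rr * (K - B₂ + 1)) := div_le_div_of_nonneg_right u2 d2.le
      _ = _ := by ring
  have main : ρ * (2 * B₂) ≤ μb * c * B₂ / (h + c * B₂ + c * rr * (K - B₂ + 1)) := by
    have e : ρ * (2 * B₂) = μb * c * B₂ / (h + 2 * t) := by rw [hρ]; field_simp
    rw [e]
    exact div_le_div_of_nonneg_left (by positivity) d2 d2le
  -- assemble: the bracket terms cancel against the `B₁`-drift, leaving `2(μ·π_b(B₂) − μ̄·π_b̄(B₂)) ≥ μ·π_b(B₂) ≥ 2ρB₂`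
  rw [f1m, f1, f2, f2m, f2p, f1p, show (B₂ : ℝ) - B₁ + B₁ + B₂ = 2 * B₂ by ring, show (B₂ : ℝ) - (B₂ - 1) = 1 by ring,
    show (B₂ : ℝ) + 1 - B₂ = 1 by ring, show (B₁ : ℝ) + 1 - B₁ = 1 by ring]
  simp only [mul_one]
  rw [down] at main
  linarith [up, main, down]

/-! ## §2 The two cold-start laws for the homogeneous Boolean star -/

section Law
open Finset Function Matrix
open Literature.Probability.MarkovChains

variable {K m : ℕ} {μ : Fin (K + 1) → Bool → ℝ} {M : Fin (K + 1) → Bool → Bool → ℝ} {w : Fin (K + 1) → ℝ} {t : ℝ}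
variable (κ : Fin m → Fin K)

/-- **THE DEFECT-COUNT RATE BY THE ONE-DIMENSIONAL ROUTE, EVERY LAW.**  Homogeneous Boolean star (`m ≥ 1` uniform entries, `0 < t < 1`, `w_0 > 0`, positive laws,
idle cold levels, exact hot redraws), liked content `b`, `rr = μ_0(b)μ_1(b̄)/(μ_0(b̄)μ_1(b))`, `h = (1−t)w_0`, `p = μ_0(b) + μ_0(b̄)rr`:
**`t_mix(ε) ≤ ⌈(4/(hρ₀))·log((eK+1)/ε)⌉₊`, `ρ₀ = (t/K)·(p·h + rr·t)/(h+2t)²`** — S8's unconditional all-`K` law with the constant `3/4` removed, via S9 with `φ ≡ 0`.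
[ours] -/
theorem boolStar_mixingTime_le_zeroPotential (hm : 1 ≤ m) (ht0 : 0 < t) (ht1 : t < 1) (hw0 : ∀ k, 0 ≤ w k) (hw00 : 0 < w 0)
    (hw1 : ∑ k, w k = 1) (hμ : ∀ k x, 0 < μ k x) (hμ1 : ∀ k, ∑ u, μ k u = 1) (hM0 : ∀ u v, M 0 u v = μ 0 v)
    (hidle : ∀ i : Fin K, ∀ u v, M i.succ u v = if v = u then 1 else 0) (hhom : ∀ i : Fin K, μ i.succ = μ 1)
    {c0 : ℕ} (hunif : ∀ i : Fin K, (univ.filter fun r : Fin m => κ r = i).card = c0)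
    {b : Bool} (hb : μ 0 b * μ 1 (!b) ≤ μ 0 (!b) * μ 1 b)
    {ε : ℝ} (hε : 0 < ε) :
    mixingTime (fun y z : Fin (K + 1) → Bool =>
        t * ptGraphSwap μ (fun r : Fin m => (((0 : Fin (K + 1)), (κ r).succ) : Fin (K + 1) × Fin (K + 1))) (fun _ : Fin m => Equiv.refl Bool) y z
          + (1 - t) * prodKernel w M y z) (tensorFun μ) ε
      ≤ ⌈1 / ((1 - t) * w 0 * ((t / K) * ((μ 0 b + μ 0 (!b) * (μ 0 b * μ 1 (!b) / (μ 0 (!b) * μ 1 b))) * ((1 - t) * w 0)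
            + (μ 0 b * μ 1 (!b) / (μ 0 (!b) * μ 1 b)) * t) / ((1 - t) * w 0 + 2 * t) ^ 2) / 4)
          * Real.log ((Real.exp 1 * (K + 2 * 0) + 1) / ε)⌉₊ := by
  let rr : ℝ := μ 0 b * μ 1 (!b) / (μ 0 (!b) * μ 1 b)
  let φ : ℝ → ℝ := fun _ => 0
  let πb : ℝ → ℝ := fun B => t / K * B / ((1 - t) * w 0 + t / K * B + t / K * rr * (K - B + 1))
  let πb' : ℝ → ℝ := fun B => t / K * (K - B) * rr / ((1 - t) * w 0 + t / K * (K - B) * rr + t / K * (B + 1))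
  have hmK : (m : ℝ) = c0 * K := uniformList_card κ hunif
  have hK1 : (1 : ℝ) ≤ K := by
    have hK0 : K ≠ 0 := by
      intro h0; have : (m : ℝ) = 0 := by rw [hmK, h0]; simp
      exact absurd (by exact_mod_cast this : m = 0) (by omega)
    exact_mod_cast Nat.one_le_iff_ne_zero.mpr hK0
  obtain ⟨-, hrr0, hrr1⟩ := boolStar_acc_disliked (acc := fun u v => min 1 (μ 0 v * μ 1 u / (μ 0 u * μ 1 v))) hμ (fun u v => rfl) hb (rr := rr) rfl
  have hh0 : 0 < (1 - t) * w 0 := mul_pos (by linarith) hw00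
  have hc0 : 0 < t / K := div_pos ht0 (by linarith)
  have hct : t / K ≤ t := div_le_self ht0.le hK1
  have htK : t = t / K * K := by field_simp
  have hsum : μ 0 b + μ 0 (!b) = 1 := by
    have := hμ1 0; rw [Fintype.sum_bool] at this; cases b <;> simp <;> linarith
  -- the rate
  have hρeq : (t / K) * ((μ 0 b + μ 0 (!b) * rr) * ((1 - t) * w 0) + rr * t) / ((1 - t) * w 0 + 2 * t) ^ 2
      = (t / K) * (μ 0 b * ((1 - t) * w 0 + rr * t) + μ 0 (!b) * rr * ((1 - t) * w 0 + t)) / ((1 - t) * w 0 + 2 * t) ^ 2 := by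
    have e : (μ 0 b + μ 0 (!b) * rr) * ((1 - t) * w 0) + rr * t = μ 0 b * ((1 - t) * w 0 + rr * t) + μ 0 (!b) * rr * ((1 - t) * w 0 + t) := by
      linear_combination (-(rr * t)) * hsum
    rw [e]
  have hp : 0 < μ 0 b + μ 0 (!b) * rr := by
    have := mul_nonneg (hμ 0 (!b)).le hrr0; linarith [hμ 0 b]
  have hnum : 0 < (μ 0 b + μ 0 (!b) * rr) * ((1 - t) * w 0) + rr * t := by
    have := mul_pos hp hh0; have := mul_nonneg hrr0 ht0.le; linarith
  have hS : 0 < (1 - t) * w 0 + 2 * t := by linarith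
  have hρ0 : 0 < (t / K) * ((μ 0 b + μ 0 (!b) * rr) * ((1 - t) * w 0) + rr * t) / ((1 - t) * w 0 + 2 * t) ^ 2 :=
    div_pos (mul_pos hc0 hnum) (pow_pos hS 2)
  have hρ1 : (t / K) * ((μ 0 b + μ 0 (!b) * rr) * ((1 - t) * w 0) + rr * t) / ((1 - t) * w 0 + 2 * t) ^ 2 ≤ 1 := by
    rw [div_le_one (pow_pos hS 2)]
    have hp1 : (μ 0 b + μ 0 (!b) * rr) ≤ 1 := by
      have := mul_le_mul_of_nonneg_left hrr1 (hμ 0 (!b)).le; linarith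
    have a1 : (μ 0 b + μ 0 (!b) * rr) * ((1 - t) * w 0) + rr * t ≤ (1 - t) * w 0 + 2 * t := by
      have := mul_le_mul_of_nonneg_right hp1 hh0.le
      have := mul_le_mul_of_nonneg_right hrr1 ht0.le
      linarith
    have a2 : t / K ≤ (1 - t) * w 0 + 2 * t := by linarith
    calc t / K * ((μ 0 b + μ 0 (!b) * rr) * ((1 - t) * w 0) + rr * t) ≤ ((1 - t) * w 0 + 2 * t) * ((1 - t) * w 0 + 2 * t) :=
          mul_le_mul a2 a1 hnum.le hS.le
      _ = ((1 - t) * w 0 + 2 * t) ^ 2 := by ring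
  have hφ0 : ∀ x, 0 ≤ φ x := fun x => le_rfl
  have hφ : ∀ x y, |φ x - φ y| ≤ |x - y| := fun x y => by simp [φ]
  have hφm : ∀ n : ℕ, n ≤ K → φ n ≤ (0 : ℝ) := fun n hn => le_rfl
  refine boolStar_mixingTime_le_of_oneCopyDrift κ hm ht0 ht1 hw0 hw00 hw1 hμ hμ1 hM0 hidle hhom hunif hb (rr := rr) rfl hφ0 hφ hφm
    (πb := πb) (πb' := πb') (fun B => rfl) (fun B => rfl) hρ0 hρ1 (fun B₁ B₂ h12 h2K => ?_) hε
  rw [hρeq]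
  exact oneCopyDrift_zero (φ := φ) hh0 hc0 hct htK hrr0 hrr1 (hμ 0 b).le (hμ 0 (!b)).le
      (fun B => rfl) (fun B => rfl) (fun x => rfl) rfl B₁ B₂ h12 (by exact_mod_cast h2K)

/-- **THE COLD-START LAW WHEN THE EQUILIBRIUM POOL IS SMALL, ALL `K`, OPTIMAL ORDER IN EVERY `t/h` REGIME.**  Homogeneous Boolean star (`m ≥ 1` uniform entries,
`0 < t < 1`, `w_0 > 0`, positive laws, idle cold levels, exact hot redraws), liked content `b`, `h = (1−t)w_0`.  If **`μ_1(b̄)·K ≤ μ_1(b)/2`**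
(⟺ `μ_0(b̄)·rr·K ≤ μ_0(b)/2`: at most half a disliked cold level at equilibrium) then **`t_mix(ε) ≤ ⌈(4/(hρ))·log((3eK+1)/ε)⌉₊`, `ρ = μ_0(b)(t/K)/(2(h + 2t))`**,
i.e. `O((K/(μ_0(b)·min{t, h}))·log(K/ε))` — the conjectured law-free order of OPEN-MATH item 1 (ii); S10's clean-cold law without the hypothesis `rr(K+1) ≤ 1/4`
and with `1/8 ↦ 1/2`, `11/32 ↦ 1/2`; via S9 with `φ(x) = max{x,0}`. [ours] -/
theorem boolStar_mixingTime_le_smallPool (hm : 1 ≤ m) (ht0 : 0 < t) (ht1 : t < 1) (hw0 : ∀ k, 0 ≤ w k) (hw00 : 0 < w 0)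
    (hw1 : ∑ k, w k = 1) (hμ : ∀ k x, 0 < μ k x) (hμ1 : ∀ k, ∑ u, μ k u = 1) (hM0 : ∀ u v, M 0 u v = μ 0 v)
    (hidle : ∀ i : Fin K, ∀ u v, M i.succ u v = if v = u then 1 else 0) (hhom : ∀ i : Fin K, μ i.succ = μ 1)
    {c0 : ℕ} (hunif : ∀ i : Fin K, (univ.filter fun r : Fin m => κ r = i).card = c0)
    {b : Bool} (hb : μ 0 b * μ 1 (!b) ≤ μ 0 (!b) * μ 1 b) (hpool : μ 1 (!b) * K ≤ μ 1 b / 2)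
    {ε : ℝ} (hε : 0 < ε) :
    mixingTime (fun y z : Fin (K + 1) → Bool =>
        t * ptGraphSwap μ (fun r : Fin m => (((0 : Fin (K + 1)), (κ r).succ) : Fin (K + 1) × Fin (K + 1))) (fun _ : Fin m => Equiv.refl Bool) y z
          + (1 - t) * prodKernel w M y z) (tensorFun μ) ε
      ≤ ⌈1 / ((1 - t) * w 0 * (μ 0 b * (t / K) / (2 * ((1 - t) * w 0 + 2 * t))) / 4) * Real.log ((Real.exp 1 * (K + 2 * K) + 1) / ε)⌉₊ := by
  let rr : ℝ := μ 0 b * μ 1 (!b) / (μ 0 (!b) * μ 1 b)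
  let φ : ℝ → ℝ := fun x => max x 0
  let πb : ℝ → ℝ := fun B => t / K * B / ((1 - t) * w 0 + t / K * B + t / K * rr * (K - B + 1))
  let πb' : ℝ → ℝ := fun B => t / K * (K - B) * rr / ((1 - t) * w 0 + t / K * (K - B) * rr + t / K * (B + 1))
  have hmK : (m : ℝ) = c0 * K := uniformList_card κ hunif
  have hK1 : (1 : ℝ) ≤ K := by
    have hK0 : K ≠ 0 := by
      intro h0; have : (m : ℝ) = 0 := by rw [hmK, h0]; simp
      exact absurd (by exact_mod_cast this : m = 0) (by omega)
    exact_mod_cast Nat.one_le_iff_ne_zero.mpr hK0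
  obtain ⟨-, hrr0, hrr1⟩ := boolStar_acc_disliked (acc := fun u v => min 1 (μ 0 v * μ 1 u / (μ 0 u * μ 1 v))) hμ (fun u v => rfl) hb (rr := rr) rfl
  have hh0 : 0 < (1 - t) * w 0 := mul_pos (by linarith) hw00
  have hc0 : 0 < t / K := div_pos ht0 (by linarith)
  have hct : t / K ≤ t := div_le_self ht0.le hK1
  have htK : t = t / K * K := by field_simp
  have hB : μ 0 (!b) * rr * K ≤ μ 0 b / 2 := by
    show μ 0 (!b) * (μ 0 b * μ 1 (!b) / (μ 0 (!b) * μ 1 b)) * K ≤ μ 0 b / 2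
    have hne1 : μ 0 (!b) ≠ 0 := (hμ 0 (!b)).ne'
    have hne2 : μ 1 b ≠ 0 := (hμ 1 b).ne'
    have e : μ 0 (!b) * (μ 0 b * μ 1 (!b) / (μ 0 (!b) * μ 1 b)) * K = μ 0 b * (μ 1 (!b) * K) / μ 1 b := by
      field_simp
    rw [e, div_le_iff₀ (hμ 1 b)]
    have := mul_le_mul_of_nonneg_left hpool (hμ 0 b).le
    linarith
  have hS : 0 < (1 - t) * w 0 + 2 * t := by linarith
  have hρ0 : 0 < μ 0 b * (t / K) / (2 * ((1 - t) * w 0 + 2 * t)) := div_pos (mul_pos (hμ 0 b) hc0) (by linarith)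
  have hρ1 : μ 0 b * (t / K) / (2 * ((1 - t) * w 0 + 2 * t)) ≤ 1 := by
    rw [div_le_one (by linarith)]
    have h1 : μ 0 b ≤ 1 := by
      have := hμ1 0; rw [Fintype.sum_bool] at this; have := hμ 0 true; have := hμ 0 false; cases b <;> simp <;> linarith
    have : μ 0 b * (t / K) ≤ 1 * t := by gcongr
    linarith
  have hφ0 : ∀ x, 0 ≤ φ x := fun x => le_max_right _ _
  have hφ : ∀ x y, |φ x - φ y| ≤ |x - y| := fun x y => abs_max_sub_max_le_abs x y 0
  have hφm : ∀ n : ℕ, n ≤ K → φ n ≤ (K : ℝ) := fun n hn => by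
    show max (n : ℝ) 0 ≤ K; rw [max_eq_left (Nat.cast_nonneg _)]; exact_mod_cast hn
  refine boolStar_mixingTime_le_of_oneCopyDrift κ hm ht0 ht1 hw0 hw00 hw1 hμ hμ1 hM0 hidle hhom hunif hb (rr := rr) rfl hφ0 hφ hφm
    (πb := πb) (πb' := πb') (fun B => rfl) (fun B => rfl) hρ0 hρ1 (fun B₁ B₂ h12 h2K => ?_) hε
  exact oneCopyDrift_smallPool (φ := φ) hh0 hc0 hct htK hrr0 hrr1 (hμ 0 b).le (hμ 0 (!b)).le hB
      (fun B => rfl) (fun B => rfl) (fun x => rfl) rfl B₁ B₂ h12 (by exact_mod_cast h2K)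

end Law

end Summit.Ventures.LatticeQCDFlow.Scaling

end
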